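import Summits.BirchSwinnertonDyer.Rank1Residual.Additive.StrictSignedControlZeroExactLocal
import Summits.BirchSwinnertonDyer.Rank1Residual.Additive.QuadraticTwistPadicNoPTorsion
import Mathlib.FieldTheory.KummerExtension
import HarnessLib

/-!
# `W(K_∞·ℚ_p)[p^∞] = 0` and `W[p^∞]^{Gal(ℚ̄/ℚ_∞)} = 0` for a quadratic TWIST `W` of a good
# supersingular curve, `p ≥ 3` — the hypotheses (htors) and (hB) of the exact bottom-layer control
# B1 ⊕ B2 DISCHARGED for the twist, so that B1 ⊕ B2 holds for `W = V ⊗ η_c` with NO auxiliary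
# hypothesis (cell `b2b-bsdres`, CLASS-CLOSURE lane, class O10 — x1b GEN 36, class lead; file 55
# of the series, after p334594 (file 49) and p316672 (gen 32 file 7))

HONEST FRAMING (cell `b2b-bsdres`, run/shared/lean/b2b/bsd-rank1-residual/, verbatim in every
file): the goal of the cell is to DELETE the COMBINATION-SHAPED residual classes of the
Birch–Swinnerton-Dyer formula for ALL analytic-rank `≤ 1` elliptic curves over `ℚ` — "full BSD
formula for every rank `≤ 1` curve in class `C`" assembled STRICTLY from published theorems — so
that the rank-`≤ 1` remainder becomes exactly the CONSTRUCTION-SHAPED classes, which are TYPED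
(missing-input `Prop`s), NOT attempted. This is not "finishing BSD". CLASS-CLOSURE lane: prove
what is provable now; shrink each hard class to its core with data; no claim beyond stated classes;
research routes on CONSTRUCTION-SHAPED X12 / O10; census / instrument output = EVIDENCE / conjecture
items, NEVER a Literature fact; `RESIDUAL-MAP.md` marks change only by signed lines. THIS FILE:
TOOL THEOREMS ONLY (transport of gen 32's Prop. 8.7-at-the-top-of-the-tower along additive-p1's
twist substitution `twistPointEquivOver` and the tree's `VariableChange.pointEquivBaseChange`, with
the auxiliary field `K₀ = ℚ(√c)` realised as Mathlib's splitting field of `X² − c`) — no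
definition, no named Literature fact, no Summits-side fact `def … : Prop`, no `sorry`, axioms
standard; nothing is booked; no label / mark / count / sub-cell moves; (C1_η), (C2_η-GZ), (C3_η)
stay typed as filed (cc-typer-6's pen); O10 stays OPEN / CONSTRUCTION-SHAPED; nothing about
`BSD(W, p)` of any pair is claimed.

## What is proved (the "(D3) on `K̄_p`-points" item of `B2-LOCALISATION-x1b.md` §3/§4)

Gen 35's B1 ⊕ B2 (`StrictSignedControlZero.finite_and_padicValNat_card_localPreimage_add_eq`)
carries, besides the dual datum, the hypotheses (htors) `E(K_∞·E)[p^∞] = 0` (no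
`Gal(K̄_E/K_∞·E)`-fixed `p`-power torsion in `E(K̄_E)`) and (hB) `E(K_∞)[p^∞] = 0` (globally); for
the good supersingular curve `V` itself both were discharged at `E = ℚ_p` (gen 32 / 35). For the
TWIST `W` (`C • W^{(c)} = V`, `c ∈ ℚ` a non-square; the consumers' `c = p* = (−1)^{p/2} p`), the
object of the (C3_η) derivation, they are discharged HERE:

* `apply_eq_self_of_mem_galRange_of_sq_eq` — an element of `galRange K₀ = Gal(K̄/K₀) ≤ Γ_K`
  fixes every square root in `K̄` of an element of `K` that is a square in `K₀`.
* **`eq_zero_of_prime_pow_smul_eq_zero_localFixedPointsOfEmb_kerSubgroup_of_quadraticTwist`** —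
  (htors) for the twist at any `ι : ℚ̄ → ℚ̄_p` and any `ℤ_p`-extension `κ` of `ℚ`: a point of
  `W(ℚ̄_p)` fixed by `Gal(ℚ̄_p/ℚ_{∞}·ℚ_p)` and killed by `p^k` is `0` — transport it by `Φ⁻¹`
  (inverse twist substitution over `ℚ̄_p ∋ t = ι(√c)`) and `C` to `V(ℚ̄_p)`; both maps are natural
  for `ℚ`-algebra maps fixing `t`, so the image is fixed by `(ker κ ⊓ galRange K₀)_{ℚ_p}`,
  `K₀ = ℚ(√c)` the splitting field of `X² − c` (Galois of degree `2 < (p² − 1)/2`, Mathlib's Kummer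
  theory), where gen 32's Prop. 8.7 at the top of the tower `K₀·ℚ_∞` kills it.
* **`fixedPoints_kerSubgroup_geomPrimaryTorsion_eq_bot_of_quadraticTwist`** — (hB) for the twist:
  `W[p^∞]^{Gal(ℚ̄/ℚ_∞)} = 0` (local-to-global).
* **`StrictSignedControlZero.finite_and_padicValNat_card_localPreimage_add_eq_of_quadraticTwist`**
  (+ `_signedPrime` for `c = p*` and a globally minimal good `a_p = 0` twin `V`) — **B1 ⊕ B2 for the
  TWIST with (hS), (htors), (hB) ALL DISCHARGED**: the only remaining inputs are the dual datum and
  its `Λ`-properties ((C1_η)-side), exactly as for `V` in file 49.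

NOT here: the count of the defect (bricks B3, B5–B7 of the global count (C)); the `η`-component
dictionary between `Sel^{−,str}(W/ℚ_n)` and `Sel⁻(V/ℚ(μ_{p^{n+1}}))^η` (n1011-p17's (P5)).

References: [Kobayashi2003] S. Kobayashi, Invent. Math. 152 (2003), Prop. 8.7 (p. 16), Lemma 9.1
(p. 25), Thm. 9.3 (p. 26); [SerreInventiones1972] §1.11 Prop. 12; [SilvermanAEC2009] X.5 Cor. 5.4;
[GreenbergLNM1716] §3 pp. 85–90, §4 Lemma 4.2 (p. 102).
-/

noncomputable section

open scoped Classical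

open Polynomial NumberField IsDedekindDomain WeierstrassCurve Literature.NumberTheory.EllipticCurves
  Literature.NumberTheory.GaloisRepresentations Literature.NumberTheory.EllipticCurves.IwasawaAlgebra
  Literature.NumberTheory.EllipticCurves.IwasawaDual Literature.NumberTheory.EllipticCurves.Kobayashi2003
  ZpExtension Summit.BirchSwinnertonDyer.Rank1Residual.AdditivePotMult

universe u

namespace Summit.BirchSwinnertonDyer.Rank1Residual.Additive

/-! ## §1 `Gal(K̄/K₀)` fixes the square roots that lie in `K₀` -/

section GalRange

variable {K : Type u} [Field K] (L : Type u) [Field L] [Algebra K L] [Algebra.IsAlgebraic K L]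

/-- **`Gal(K̄/K₀)` fixes `√c ∈ K̄` when `c` is a square in `K₀`.** For `L/K` algebraic containing
`r` with `r² = c`, every `g ∈ galRange L` (the image of `Γ_L → Γ_K` along the chosen embedding
`K̄ → L̄`) fixes every `s ∈ K̄` with `s² = c`: along `K̄ ≃ L̄` the element `s` goes to `±r`, which
`Γ_L` fixes. Serre, *Galois Cohomology*, II.§1.1. [folklore] -/
theorem apply_eq_self_of_mem_galRange_of_sq_eq {c : K} {r : L} (hr : r ^ 2 = algebraMap K L c)
    {s : AlgebraicClosure K} (hs : s ^ 2 = algebraMap K (AlgebraicClosure K) c)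
    {g : Field.absoluteGaloisGroup K} (hg : g ∈ galRange (K := K) L) :
    (show AlgebraicClosure K ≃ₐ[K] AlgebraicClosure K from g) s = s := by
  obtain ⟨τ, rfl⟩ := (mem_galRange_iff L g).mp hg
  set e := algEquivOfEmb L (closureEmb (K := K) L) with he
  have key := algEquivOfEmb_resGal_apply (K := K) L τ s
  -- `e s` is `± r`
  have hes : (e s) ^ 2 = (algebraMap L (AlgebraicClosure L) r) ^ 2 := by
    rw [← map_pow, hs, AlgEquiv.commutes, ← map_pow, hr, ← IsScalarTower.algebraMap_apply]
  have hfix : (show AlgebraicClosure L ≃ₐ[L] AlgebraicClosure L from τ) (e s) = e s := by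
    rcases sq_eq_sq_iff_eq_or_eq_neg.mp hes with h | h
    · rw [h, AlgEquiv.commutes]
    · rw [h, map_neg, AlgEquiv.commutes]
  rw [hfix] at key
  exact e.injective key

end GalRange

/-! ## §2 (htors) for the twist: `W(K_∞·ℚ_p)` has no `p`-power torsion -/

section Local

variable {p : ℕ} [hp : Fact p.Prime] (κ : ZpExtension ℚ p)
  (ι : AlgebraicClosure ℚ →ₐ[ℚ] AlgebraicClosure ℚ_[p])

/-- `2 < (p² − 1)/2` for a prime `p ≠ 2`. [folklore] -/
theorem two_lt_half_sq_sub_one (hp2 : p ≠ 2) : 2 < (p ^ 2 - 1) / 2 := by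
  have hp3 : 3 ≤ p := by
    rcases Nat.lt_or_ge p 3 with h | h
    · exfalso
      interval_cases p
      · exact hp.out.ne_zero rfl
      · exact hp.out.ne_one rfl
      · exact hp2 rfl
    · exact h
  have h9 : 9 ≤ p ^ 2 := by nlinarith
  omega

/-- **(htors) for a quadratic twist of a good supersingular curve, `p ≥ 3`.** Let `c ∈ ℚ` be a
non-square, `C • W^{(c)} = V`, and `M/ℤ_p` a good supersingular model of `V` over `ℚ̄_p`
(`Δ(M) ∈ ℤ_p^×`, `A_p(M) ∈ pℤ_p`, `M ⊗ ℚ̄_p = V ⊗ ℚ̄_p`). Then for every `ℤ_p`-extension `κ` of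
`ℚ` and every embedding `ι : ℚ̄ → ℚ̄_p`, a point of `W(ℚ̄_p)` fixed by `Gal(ℚ̄_p/ℚ_∞·ℚ_p)`
(`(ker κ)_{ℚ_p}`) and killed by `p^k` is `0`: its transport to `V(ℚ̄_p)` by the inverse twist
substitution over `ℚ̄_p ∋ ι(√c)` and by `C` is fixed by `(towerTopSubgroup κ ℚ(√c))_{ℚ_p}`
(`ℚ(√c)` = the splitting field of `X² − c`, Galois of degree `2 < (p² − 1)/2`), where gen 32's
Prop. 8.7 at the top of the tower applies. [cite: Kobayashi2003, Prop. 8.7 (p. 16)]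
[cite: SerreInventiones1972, §1.11 Prop. 12] [cite: SilvermanAEC2009, X.5 Cor. 5.4] -/
theorem eq_zero_of_prime_pow_smul_eq_zero_localFixedPointsOfEmb_kerSubgroup_of_quadraticTwist'
    (hp2 : p ≠ 2) (W : WeierstrassCurve ℚ) {c : ℚ} (hc : ∀ q : ℚ, q ^ 2 ≠ c) (C : VariableChange ℚ)
    {V : WeierstrassCurve ℚ} [V.IsElliptic] (hCV : C • W.quadraticTwist c = V)
    (M : WeierstrassCurve ℤ_[p]) (hΔ : IsUnit M.Δ)
    (hA : M.hasseCoeff p ∈ IsLocalRing.maximalIdeal ℤ_[p])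
    (hVM : M.baseChange (AlgebraicClosure ℚ_[p]) = V.baseChange (AlgebraicClosure ℚ_[p])) (k : ℕ) :
    ∀ Q ∈ localFixedPointsOfEmb ι W κ.kerSubgroup, p ^ k • Q = 0 → Q = 0 := by
  -- the auxiliary field `K₀ = ℚ(√c)`
  have H : Irreducible (X ^ 2 - Polynomial.C c) := X_pow_sub_C_irreducible_of_prime Nat.prime_two hc
  have hζ : (primitiveRoots 2 ℚ).Nonempty :=
    ⟨-1, (mem_primitiveRoots two_pos).2 (IsPrimitiveRoot.neg_one 0 (by norm_num))⟩
  let K₀ : Type := (X ^ 2 - Polynomial.C c : ℚ[X]).SplittingField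
  haveI hsf : IsSplittingField ℚ K₀ (X ^ 2 - Polynomial.C c) :=
    Polynomial.IsSplittingField.splittingField _
  haveI : FiniteDimensional ℚ K₀ := IsSplittingField.finiteDimensional K₀ (X ^ 2 - Polynomial.C c)
  haveI : IsGalois ℚ K₀ := isGalois_of_isSplittingField_X_pow_sub_C hζ H K₀
  haveI : NumberField K₀ := NumberField.of_module_finite ℚ K₀
  haveI : (galRange (K := ℚ) K₀).Normal := RelModel.normal_galRange (K := ℚ) K₀
  have hdeg : Module.finrank ℚ K₀ = 2 := finrank_of_isSplittingField_X_pow_sub_C hζ H K₀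
  have hlt : Module.finrank ℚ K₀ < (p ^ 2 - 1) / 2 := hdeg.trans_lt (two_lt_half_sq_sub_one hp2)
  obtain ⟨hK0, hK⟩ := index_galRange_ne_zero_and_lt (p := p) (K := ℚ) K₀ hlt
  -- a square root `r` of `c` in `K₀`
  obtain ⟨r, hr⟩ : ∃ r : K₀, r ^ 2 = algebraMap ℚ K₀ c := by
    have hspl := IsSplittingField.splits K₀ (X ^ 2 - Polynomial.C c : ℚ[X])
    have hd : ((X ^ 2 - Polynomial.C c : ℚ[X]).map (algebraMap ℚ K₀)).degree ≠ 0 := by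
      rw [Polynomial.map_sub, Polynomial.map_pow, map_X, map_C, degree_X_pow_sub_C two_pos]
      norm_num
    obtain ⟨r, hr⟩ := hspl.exists_eval_eq_zero hd
    refine ⟨r, ?_⟩
    rw [Polynomial.map_sub, Polynomial.map_pow, map_X, map_C, eval_sub, eval_pow, eval_X, eval_C,
      sub_eq_zero] at hr
    exact hr
  -- a square root `t = ι s` of `c` in `ℚ̄_p`
  obtain ⟨s, hsc⟩ :=
    IsAlgClosed.exists_pow_nat_eq (algebraMap ℚ (AlgebraicClosure ℚ) c) two_pos
  have htc : (ι s) ^ 2 = algebraMap ℚ (AlgebraicClosure ℚ_[p]) c := by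
    rw [← map_pow, hsc, AlgHom.commutes]
  have ht : ι s ∉ Set.range (algebraMap ℚ (AlgebraicClosure ℚ_[p])) :=
    not_mem_range_algebraMap_of_sq_eq htc hc
  subst hCV
  intro Q hQ hpQ
  -- work at the level of `(W ⊗ ℚ̄_p).Point` (`localPoints` is a type synonym)
  change (W.baseChange (AlgebraicClosure ℚ_[p])).toAffine.Point at Q
  replace hpQ : p ^ k • Q = 0 := hpQ
  -- transport to `V = C • W^{(c)}` over `ℚ̄_p`
  set Φ := twistPointEquivOver W ht htc with hΦ
  set Ψ := VariableChange.pointEquivBaseChange (W.quadraticTwist c) C (AlgebraicClosure ℚ_[p])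
    with hΨ
  have hpP : p ^ k • Ψ (Φ.symm Q) = 0 := by
    rw [← map_nsmul, ← map_nsmul, hpQ, map_zero, map_zero]
  -- `Ψ (Φ⁻¹ Q)` is fixed by `(towerTopSubgroup κ K₀)_{ℚ_p}`
  have hPfix : (show localPoints (C • W.quadraticTwist c) ℚ_[p] from Ψ (Φ.symm Q)) ∈
      localFixedPointsOfEmb ι (C • W.quadraticTwist c) (towerTopSubgroup κ K₀) := by
    rw [mem_localFixedPointsOfEmb_iff]
    intro σ hσ
    rw [mem_localSubgroupOfEmb_iff, mem_towerTopSubgroup_iff] at hσ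
    obtain ⟨hσκ, hσ0⟩ := hσ
    -- `σ` fixes `t = ι s`
    have h2 : (show AlgebraicClosure ℚ ≃ₐ[ℚ] AlgebraicClosure ℚ from resGalAuxOfEmb ι σ) s = s :=
      apply_eq_self_of_mem_galRange_of_sq_eq K₀ hr hsc hσ0
    have hgt : ((AlgEquiv.restrictScalars ℚ
        (show AlgebraicClosure ℚ_[p] ≃ₐ[ℚ_[p]] AlgebraicClosure ℚ_[p] from σ) :
          AlgebraicClosure ℚ_[p] ≃ₐ[ℚ] AlgebraicClosure ℚ_[p]) :
        AlgebraicClosure ℚ_[p] →ₐ[ℚ] AlgebraicClosure ℚ_[p]) (ι s) = ι s := by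
      have h1 := apply_resGalAuxOfEmb_apply ι σ s
      exact h1.symm.trans (congrArg ι h2)
    -- `σ` fixes `Q`
    have hσQ : Affine.Point.map ((AlgEquiv.restrictScalars ℚ
        (show AlgebraicClosure ℚ_[p] ≃ₐ[ℚ_[p]] AlgebraicClosure ℚ_[p] from σ) :
          AlgebraicClosure ℚ_[p] ≃ₐ[ℚ] AlgebraicClosure ℚ_[p]) :
        AlgebraicClosure ℚ_[p] →ₐ[ℚ] AlgebraicClosure ℚ_[p]) Q = Q :=
      (mem_localFixedPointsOfEmb_iff ι W κ.kerSubgroup Q).mp hQ σ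
        ((mem_localSubgroupOfEmb_iff κ.kerSubgroup ι σ).mpr hσκ)
    have hgΦ : Affine.Point.map ((AlgEquiv.restrictScalars ℚ
        (show AlgebraicClosure ℚ_[p] ≃ₐ[ℚ_[p]] AlgebraicClosure ℚ_[p] from σ) :
          AlgebraicClosure ℚ_[p] ≃ₐ[ℚ] AlgebraicClosure ℚ_[p]) :
        AlgebraicClosure ℚ_[p] →ₐ[ℚ] AlgebraicClosure ℚ_[p]) (Φ.symm Q) = Φ.symm Q := by
      have h := map_twistPointEquivOver W ht htc ht htc _ hgt (Φ.symm Q)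
      rw [← hΦ, AddEquiv.apply_symm_apply, hσQ] at h
      rw [(AddEquiv.eq_symm_apply Φ).mpr h.symm]
    change Affine.Point.map ((AlgEquiv.restrictScalars ℚ
        (show AlgebraicClosure ℚ_[p] ≃ₐ[ℚ_[p]] AlgebraicClosure ℚ_[p] from σ) :
          AlgebraicClosure ℚ_[p] ≃ₐ[ℚ] AlgebraicClosure ℚ_[p]) :
        AlgebraicClosure ℚ_[p] →ₐ[ℚ] AlgebraicClosure ℚ_[p]) (Ψ (Φ.symm Q)) = Ψ (Φ.symm Q)
    rw [VariableChange.pointEquivBaseChange_map, hgΦ]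
  -- Prop. 8.7 at the top of the tower for `V`
  have hP0 : Ψ (Φ.symm Q) = 0 :=
    eq_zero_of_prime_pow_smul_eq_zero_localFixedPointsOfEmb_towerTopSubgroup_padic κ K₀ ι
      (C • W.quadraticTwist c) hp2 M hΔ hA hVM hK0 hK k _ hPfix hpP
  -- back to `Q`
  have h1 : Φ.symm Q = 0 := by
    apply Ψ.injective
    rw [map_zero]
    exact hP0
  have h3 : Q = Φ 0 := (AddEquiv.symm_apply_eq Φ).mp h1
  rw [map_zero] at h3
  exact h3

/-- **(htors) for the twist, in the form consumed by B1 ⊕ B2** (`∃ j, p^j • P = 0`; file 49's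
hypothesis `htors` at `E = ℚ_p`, `K = ℚ`). [cite: Kobayashi2003, Prop. 8.7 (p. 16)]
[cite: SerreInventiones1972, §1.11 Prop. 12] -/
theorem eq_zero_of_prime_pow_smul_eq_zero_localFixedPointsOfEmb_kerSubgroup_of_quadraticTwist
    (hp2 : p ≠ 2) (W : WeierstrassCurve ℚ) {c : ℚ} (hc : ∀ q : ℚ, q ^ 2 ≠ c) (C : VariableChange ℚ)
    {V : WeierstrassCurve ℚ} [V.IsElliptic] (hCV : C • W.quadraticTwist c = V)
    (M : WeierstrassCurve ℤ_[p]) (hΔ : IsUnit M.Δ)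
    (hA : M.hasseCoeff p ∈ IsLocalRing.maximalIdeal ℤ_[p])
    (hVM : M.baseChange (AlgebraicClosure ℚ_[p]) = V.baseChange (AlgebraicClosure ℚ_[p])) :
    ∀ P : localPoints W ℚ_[p], P ∈ localFixedPointsOfEmb ι W κ.kerSubgroup →
      (∃ j : ℕ, p ^ j • P = 0) → P = 0 := by
  rintro P hP ⟨j, hj⟩
  exact eq_zero_of_prime_pow_smul_eq_zero_localFixedPointsOfEmb_kerSubgroup_of_quadraticTwist' κ ι
    hp2 W hc C hCV M hΔ hA hVM j P hP hj

end Local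

/-! ## §3 (hB) for the twist: `W[p^∞]^{Gal(ℚ̄/ℚ_∞)} = 0` -/

section Global

variable {p : ℕ} [hp : Fact p.Prime] (κ : ZpExtension ℚ p)

/-- **(hB) for a quadratic twist of a good supersingular curve, `p ≥ 3`: `W[p^∞]^{Gal(ℚ̄/ℚ_∞)} = 0`.**
Same data as §2 (`c` a non-square, `C • W^{(c)} = V`, `M` a good supersingular `ℤ_p`-model of `V`
over `ℚ̄_p`); for every `ℤ_p`-extension `κ` of `ℚ` the `ker κ`-fixed points of the `p`-primary
torsion `W[p^∞] ⊆ W(ℚ̄)` are trivial — §2 at the chosen embedding `ℚ̄ → ℚ̄_p` plus gen 32's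
local-to-global injection `eq_zero_of_pow_smul_eq_zero_of_forall_smul_eq_of_local`. This is the
vanishing behind [K] Lemma 9.1 / the inflation–restriction step of the bottom-layer control for the
TWIST. [cite: Kobayashi2003, Prop. 8.7 (p. 16), Lemma 9.1 (p. 25)] [cite: GreenbergLNM1716, §3] -/
theorem fixedPoints_kerSubgroup_geomPrimaryTorsion_eq_bot_of_quadraticTwist (hp2 : p ≠ 2)
    (W : WeierstrassCurve ℚ) {c : ℚ} (hc : ∀ q : ℚ, q ^ 2 ≠ c) (C : VariableChange ℚ)
    {V : WeierstrassCurve ℚ} [V.IsElliptic] (hCV : C • W.quadraticTwist c = V)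
    (M : WeierstrassCurve ℤ_[p]) (hΔ : IsUnit M.Δ)
    (hA : M.hasseCoeff p ∈ IsLocalRing.maximalIdeal ℤ_[p])
    (hVM : M.baseChange (AlgebraicClosure ℚ_[p]) = V.baseChange (AlgebraicClosure ℚ_[p])) :
    FixedPoints.addSubgroup κ.kerSubgroup (W.geomPrimaryTorsion p) = ⊥ := by
  rw [eq_bot_iff]
  intro m hm
  rw [AddSubgroup.mem_bot]
  rw [FixedPoints.mem_addSubgroup] at hm
  obtain ⟨k, hk⟩ := m.2
  have hP : ∀ σ ∈ κ.kerSubgroup, σ • ((m : W.geomPrimaryTorsion p) : geomPoints W) =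
      ((m : W.geomPrimaryTorsion p) : geomPoints W) := by
    intro σ hσ
    have h := hm ⟨σ, hσ⟩
    rw [Subgroup.mk_smul] at h
    rw [← primaryComponent.coe_smul, h]
  have h0 : ((m : W.geomPrimaryTorsion p) : geomPoints W) = 0 :=
    eq_zero_of_pow_smul_eq_zero_of_forall_smul_eq_of_local (closureEmb (K := ℚ) ℚ_[p]) W
      κ.kerSubgroup
      (eq_zero_of_prime_pow_smul_eq_zero_localFixedPointsOfEmb_kerSubgroup_of_quadraticTwist' κ
        (closureEmb (K := ℚ) ℚ_[p]) hp2 W hc C hCV M hΔ hA hVM k) hP hk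
  exact Subtype.ext h0

end Global

/-! ## §4 B1 ⊕ B2 for the TWIST with (hS), (htors), (hB) discharged -/

namespace StrictSignedControlZero

variable {p : ℕ} [hp : Fact p.Prime] (κ : ZpExtension ℚ p) (W : WeierstrassCurve ℚ) [W.IsElliptic]
  (ε : ℤˣ)

/-- **B1 ⊕ B2 for a quadratic TWIST of a good supersingular curve, model form, NO auxiliary
hypothesis.** For `W/ℚ` elliptic with `C • W^{(c)} = V` (`c ∈ ℚ` a non-square), `M/ℤ_p` a good
supersingular model of `V` over `ℚ̄_p` (`Δ(M)` a unit, `A_p(M) ∈ pℤ_p`, `M ⊗ ℚ̄_p = V ⊗ ℚ̄_p`),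
`p ≥ 3`, any `ℤ_p`-extension `κ` of `ℚ` with topological generator `γ`, any sign `ε`, and a strict
signed dual datum `D` of `Sel^{ε,str}(W/ℚ_∞)` (model `ℚ_p`) with `X` f.g. torsion, no finite
submodule, `char = (f)`, `f(0) ≠ 0`:
**`ord_p #Sel^{ε,str}(W/ℚ) + ord_p #(Sel^{loc,∞}(W/ℚ) ⧸ Sel^{ε,str}(W/ℚ)) = ord_p f(0)`**, both
groups finite — file 49's `finite_and_padicValNat_card_localPreimage_add_eq` with (hS)
(`exists_finset_forall_not_mem_good`), (hB) (§3) and (htors) (§2) discharged for the twist.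
[cite: Kobayashi2003, Prop. 8.7 (p. 16), Lemma 9.1 (p. 25), Thm. 9.3 (p. 26)]
[cite: GreenbergLNM1716, §3 pp. 85–90 and §4 Lemma 4.2 (p. 102)] -/
theorem finite_and_padicValNat_card_localPreimage_add_eq_of_quadraticTwist (hp2 : p ≠ 2)
    {c : ℚ} (hc : ∀ q : ℚ, q ^ 2 ≠ c) (C : VariableChange ℚ)
    {V : WeierstrassCurve ℚ} [V.IsElliptic] (hCV : C • W.quadraticTwist c = V)
    (M : WeierstrassCurve ℤ_[p]) (hΔ : IsUnit M.Δ)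
    (hA : M.hasseCoeff p ∈ IsLocalRing.maximalIdeal ℤ_[p])
    (hVM : M.baseChange (AlgebraicClosure ℚ_[p]) = V.baseChange (AlgebraicClosure ℚ_[p]))
    {γ : Field.absoluteGaloisGroup ℚ} (hγ : κ.IsTopGenerator γ)
    (D : StrictSignedSelmerDualData W κ ℚ_[p] γ ε)
    [Module.Finite (IwasawaAlgebra p) D.X] (hX : Module.IsTorsion (IwasawaAlgebra p) D.X)
    (hnf : ∀ N : Submodule (IwasawaAlgebra p) D.X, Finite N → N = ⊥)
    {f : IwasawaAlgebra p} (hf : D.charIdeal = Ideal.span {f})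
    (h0 : PowerSeries.constantCoeff f ≠ 0) :
    Finite (strictSignedSelmerLayer W κ ℚ_[p] ε 0) ∧
      Finite (↥((W.selmerInfty κ ⊓
          ⨅ σ : Field.absoluteGaloisGroup ℚ,
            (localKummerOverOfEmb W p κ.kerSubgroup (closureEmb (K := ℚ) ℚ_[p])
                (⨆ m, strictSignedLocalPoints κ ℚ_[p] W ε m)).comap (W.conjH1 p κ.kerSubgroup σ)).comap
          (W.layerToInfty κ 0)) ⧸
        (strictSignedSelmerLayer W κ ℚ_[p] ε 0).addSubgroupOf ((W.selmerInfty κ ⊓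
          ⨅ σ : Field.absoluteGaloisGroup ℚ,
            (localKummerOverOfEmb W p κ.kerSubgroup (closureEmb (K := ℚ) ℚ_[p])
                (⨆ m, strictSignedLocalPoints κ ℚ_[p] W ε m)).comap (W.conjH1 p κ.kerSubgroup σ)).comap
          (W.layerToInfty κ 0))) ∧
      (padicValNat p (Nat.card (strictSignedSelmerLayer W κ ℚ_[p] ε 0)) : ℤ) +
          padicValNat p (Nat.card (↥((W.selmerInfty κ ⊓
            ⨅ σ : Field.absoluteGaloisGroup ℚ,
              (localKummerOverOfEmb W p κ.kerSubgroup (closureEmb (K := ℚ) ℚ_[p])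
                  (⨆ m, strictSignedLocalPoints κ ℚ_[p] W ε m)).comap (W.conjH1 p κ.kerSubgroup σ)).comap
            (W.layerToInfty κ 0)) ⧸
          (strictSignedSelmerLayer W κ ℚ_[p] ε 0).addSubgroupOf ((W.selmerInfty κ ⊓
            ⨅ σ : Field.absoluteGaloisGroup ℚ,
              (localKummerOverOfEmb W p κ.kerSubgroup (closureEmb (K := ℚ) ℚ_[p])
                  (⨆ m, strictSignedLocalPoints κ ℚ_[p] W ε m)).comap (W.conjH1 p κ.kerSubgroup σ)).comap
            (W.layerToInfty κ 0)))) =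
        ((PowerSeries.constantCoeff f : ℤ_[p]) : ℚ_[p]).valuation := by
  obtain ⟨S, hS⟩ := exists_finset_forall_not_mem_good W p
  exact finite_and_padicValNat_card_localPreimage_add_eq W κ ℚ_[p] ε hγ D hX
    (fixedPoints_kerSubgroup_geomPrimaryTorsion_eq_bot_of_quadraticTwist κ hp2 W hc C hCV M hΔ hA
      hVM) hnf hf h0 S hS
    (eq_zero_of_prime_pow_smul_eq_zero_localFixedPointsOfEmb_kerSubgroup_of_quadraticTwist κ
      (closureEmb (K := ℚ) ℚ_[p]) hp2 W hc C hCV M hΔ hA hVM)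

/-- **B1 ⊕ B2 for the `p*`-twist `W` of a globally minimal good supersingular `a_p = 0` curve `V`,
NO auxiliary hypothesis** — the consumers' binders: `C • W.quadraticTwist ((−1)^{p/2} p) = V`,
`V.IsGloballyMinimal`, `V.HasGoodReductionAtPrime p`, `V.frobeniusTrace p = 0`, `p ≥ 3` (gen 32's
`exists_goodSupersingularPadicModel` supplies the model; `p*` is not a square). For `κ` cyclotomic
and `ε = −1` this is the exact bottom-layer control of Kobayashi's strict-minus structure for the
TWIST `W = V ⊗ η` of the (C3_η) derivation, with the defect written by local conditions; its only
remaining inputs are the dual datum and its `Λ`-module properties.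
[cite: Kobayashi2003, Prop. 8.7 (p. 16), Lemma 9.1 (p. 25), Thm. 9.3 (p. 26)]
[cite: GreenbergLNM1716, §3 pp. 85–90 and §4 Lemma 4.2 (p. 102)] -/
theorem finite_and_padicValNat_card_localPreimage_add_eq_of_quadraticTwist_signedPrime
    (hp2 : p ≠ 2) (C : VariableChange ℚ) (V : WeierstrassCurve ℚ) [V.IsElliptic]
    [V.IsGloballyMinimal] (hCV : C • W.quadraticTwist ((-1) ^ (p / 2) * p) = V)
    (hgood : V.HasGoodReductionAtPrime p) (hap : V.frobeniusTrace p = 0)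
    {γ : Field.absoluteGaloisGroup ℚ} (hγ : κ.IsTopGenerator γ)
    (D : StrictSignedSelmerDualData W κ ℚ_[p] γ ε)
    [Module.Finite (IwasawaAlgebra p) D.X] (hX : Module.IsTorsion (IwasawaAlgebra p) D.X)
    (hnf : ∀ N : Submodule (IwasawaAlgebra p) D.X, Finite N → N = ⊥)
    {f : IwasawaAlgebra p} (hf : D.charIdeal = Ideal.span {f})
    (h0 : PowerSeries.constantCoeff f ≠ 0) :
    Finite (strictSignedSelmerLayer W κ ℚ_[p] ε 0) ∧
      Finite (↥((W.selmerInfty κ ⊓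
          ⨅ σ : Field.absoluteGaloisGroup ℚ,
            (localKummerOverOfEmb W p κ.kerSubgroup (closureEmb (K := ℚ) ℚ_[p])
                (⨆ m, strictSignedLocalPoints κ ℚ_[p] W ε m)).comap (W.conjH1 p κ.kerSubgroup σ)).comap
          (W.layerToInfty κ 0)) ⧸
        (strictSignedSelmerLayer W κ ℚ_[p] ε 0).addSubgroupOf ((W.selmerInfty κ ⊓
          ⨅ σ : Field.absoluteGaloisGroup ℚ,
            (localKummerOverOfEmb W p κ.kerSubgroup (closureEmb (K := ℚ) ℚ_[p])
                (⨆ m, strictSignedLocalPoints κ ℚ_[p] W ε m)).comap (W.conjH1 p κ.kerSubgroup σ)).comap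
          (W.layerToInfty κ 0))) ∧
      (padicValNat p (Nat.card (strictSignedSelmerLayer W κ ℚ_[p] ε 0)) : ℤ) +
          padicValNat p (Nat.card (↥((W.selmerInfty κ ⊓
            ⨅ σ : Field.absoluteGaloisGroup ℚ,
              (localKummerOverOfEmb W p κ.kerSubgroup (closureEmb (K := ℚ) ℚ_[p])
                  (⨆ m, strictSignedLocalPoints κ ℚ_[p] W ε m)).comap (W.conjH1 p κ.kerSubgroup σ)).comap
            (W.layerToInfty κ 0)) ⧸
          (strictSignedSelmerLayer W κ ℚ_[p] ε 0).addSubgroupOf ((W.selmerInfty κ ⊓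
            ⨅ σ : Field.absoluteGaloisGroup ℚ,
              (localKummerOverOfEmb W p κ.kerSubgroup (closureEmb (K := ℚ) ℚ_[p])
                  (⨆ m, strictSignedLocalPoints κ ℚ_[p] W ε m)).comap (W.conjH1 p κ.kerSubgroup σ)).comap
            (W.layerToInfty κ 0)))) =
        ((PowerSeries.constantCoeff f : ℤ_[p]) : ℚ_[p]).valuation := by
  obtain ⟨M, hΔ, hA, hVM⟩ := exists_goodSupersingularPadicModel hp2 V hgood hap
  exact finite_and_padicValNat_card_localPreimage_add_eq_of_quadraticTwist κ W ε hp2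
    (sq_ne_neg_one_pow_mul_prime hp.out (p / 2)) C hCV M hΔ hA hVM hγ D hX hnf hf h0

end StrictSignedControlZero

end Summit.BirchSwinnertonDyer.Rank1Residual.Additive

end
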